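import Literature.Computability.Cryptography.QuantumCircuit
import Literature.Computability.Cryptography.ClassBQP
import Literature.Computability.Complexity.Classes
import HarnessLib

/-!
# The homogeneous XXZ brickwork ("integrable Trotterization") and the class `XXZBQP`

Topic `Literature/Computability/QuantumComplexity`, model namespace `IntegrableBrickwork`.
Definition request `defn-IntegrableBrickwork` of route `QuantumAdvantage/YangBaxterIslands`, whose
statement items (`YbTarget`, `YbIsland`, `YbHardness`, `YbMembership`, …) inline the terms below
VERBATIM; the bridge lemmas `mem_XXZBQPAt_iff` / `mem_XXZBQP_iff` restate membership against that
literal signature (proof `simp only [...]; rfl`), so provers may `rw` either way.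

* `xxzGate θ φ` — the two-qubit gate `exp(-i(θ (X⊗X + Y⊗Y) + φ Z⊗Z))` written out in the
  computational basis (`QReg 2 = Fin 2 → Bool`): `|00⟩, |11⟩ ↦ e^{-iφ}|00⟩, e^{-iφ}|11⟩`, and on
  `span{|01⟩, |10⟩}` the block `e^{iφ} [[cos 2θ, -i sin 2θ], [-i sin 2θ, cos 2θ]]`. Up to the global
  phase `e^{iφ}` this is the local propagator
  `U_{n,n+1} = exp(-iτ(σˣσˣ + σʸσʸ) - iτ'(σᶻσᶻ - 𝟙))` (`τ = θ`, `τ' = φ`) of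
  Ljubotina–Zadnik–Prosen, which they rewrite as the braid form `Ř(λ)` of the six-vertex (XXZ)
  `R`-matrix; the brickwork Floquet operator `𝒰 = 𝒰_odd 𝒰_even` built from it equals
  `T(-x)⁻¹ T(x)` at a special value `x` of the spectral parameter of a commuting family of
  staggered transfer matrices, i.e. it is Yang–Baxter integrable for every `(θ, φ)`
  [LjubotinaZadnikProsen2019, eqs. (2)–(4) and Suppl. App. B; VanicatZadnikProsen2018, eqs. (3)–(4),
  (7)–(8) for the XXX point].
* `xxzGateSet θ φ` (one symbol of arity `2`), `bond N j`, `brickLayer θ φ N s` (the gate on every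
  bond `(j, j+1)` with `j ≡ s (mod 2)`, open chain), `brickwork θ φ N t` (layers `0, …, t-1`, even
  layer first), `xxzAccept`, `xxzFamily θ φ p q` (`p n` ancillas, depth `q n` on inputs of length
  `n`), and the classes `XXZBQPAt a b` (angles `θ = aπ`, `φ = bπ`, `a b : ℚ`; error `≤ 1/3` on
  wire `0` after a deterministic poly-time input encoding `f ∈ FP`) and
  `XXZBQP = ⋃_{a,b} XXZBQPAt a b`.
* API (all proved): entry formula `xxzGate_apply`; `U(1)` (Hamming-weight) conservation
  `xxzGate_apply_eq_zero_of_weight_ne`; unitarity `xxzGate_mem_unitaryGroup`,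
  `xxzGateSet_isUnitary`; the two classical lines `xxzGate_of_sin_eq_zero` (diagonal gate,
  `a ∈ ½ℤ`) and `xxzGate_of_cos_eq_zero` (SWAP times a diagonal, `a ∈ ¼ + ½ℤ`); bookkeeping
  `brickwork_isOracleFree`, `length_brickLayer_le`, `size_brickwork_le`, `brickwork_succ`,
  `toMatrix_brickwork_succ` (depth recursion `U_{t+1} = U_{layer t} U_t`), `acceptProbOn_xxzFamily`,
  `XXZBQPAt_subset_XXZBQP`; the literal bridges `mem_XXZBQPAt_iff`, `mem_XXZBQP_iff`.

## Sources

* M. Ljubotina, L. Zadnik, T. Prosen, *Ballistic spin transport in a periodically driven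
  integrable quantum system*, Phys. Rev. Lett. 122 (2019) 150605 = arXiv:1901.05398: eq. (2)
  (`𝒰 = 𝒰_odd 𝒰_even`), eq. (3) (the gate `U_{n,n+1}`), eq. (4) (`U = Ř(λ)`, braid six-vertex
  `R`-matrix), "Spin currents" (the `U(1)` symmetry), Suppl. App. B (`T(-x)⁻¹T(x) = 𝒰_odd 𝒰_even`).
* M. Vanicat, L. Zadnik, T. Prosen, *Integrable Trotterization: local conservation laws and
  boundary driving*, Phys. Rev. Lett. 121 (2018) 030606 = arXiv:1712.00431, eqs. (3)–(4), (7)–(8).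

## Mathlib / tree

Mathlib has no quantum circuits; searched `XXZ|sixVertex|YangBaxter|brickwork|matchgate` in the
tree: nothing beyond unrelated `…Bricks` files. Built on `QReg`, `QGateSet`, `placeGate` (Q1),
`QGate`, `QCircuit`, `QCircuitFamily`, `acceptProb(On)` (Q2), `FP` (G01).

## Design choices

* The terms of `xxzGate` … `XXZBQP` are kept LITERALLY as in the planner's sketch (the route items
  inline them); in particular the gate alphabet is `Unit`, the chain is open, layer `s` acts on the
  bonds `(j, j+1)` with `j % 2 = s % 2 ∧ j + 1 < N`, rows of a matrix index the OUTPUT basis state,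
  and the program is written into the initial product state `|f x⟩|0^{p |f x|}⟩` only.
* `XXZBQPAt` does not ask for uniformity of the family: the brickwork is explicit and `f ∈ FP`
  carries all the uniformity (membership in `BQP` is route item `YbMembership`, not claimed here).
* Junk values are those of Q2 (`acceptProb` on the empty register is `0`).

## Not here

The matchgate property at `φ ∈ (π/2)ℤ` (no matchgate notion in the tree yet), the anisotropy
formula, periodic boundary conditions (the literal model of VZP18/LZP19 is periodic; the route
uses the open chain), and any complexity CLAIM about `XXZBQP` (those are the route's items).
-/

open Matrix Literature.Computability.Cryptography Literature.Computability.Complexity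

namespace Literature.Computability.QuantumComplexity.IntegrableBrickwork

/-! ### The gate, the brickwork and the class (terms literal for route `YangBaxterIslands`) -/

/-- The two-qubit XXZ gate `exp(-i(θ (X⊗X + Y⊗Y) + φ Z⊗Z))` in the computational basis:
`|00⟩ ↦ e^{-iφ}|00⟩`, `|11⟩ ↦ e^{-iφ}|11⟩`, and on `span{|01⟩,|10⟩}` the block
`e^{iφ} [[cos 2θ, -i sin 2θ], [-i sin 2θ, cos 2θ]]` (indeed `X⊗X + Y⊗Y` vanishes on `|00⟩, |11⟩`
and is `2σˣ` on the odd block, `Z⊗Z = ±1` on the even/odd block). Up to the global phase `e^{iφ}`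
this is the local propagator `U_{n,n+1} = exp(-iτ(σˣσˣ+σʸσʸ) - iτ'(σᶻσᶻ-𝟙))`, `τ = θ`, `τ' = φ`,
of Ljubotina–Zadnik–Prosen, the braid-form six-vertex `Ř`-matrix.
[cite: LjubotinaZadnikProsen2019, eqs. (3)–(4)] -/
noncomputable def xxzGate (θ φ : ℝ) : Matrix (QReg 2) (QReg 2) ℂ :=
  Matrix.of fun x y =>
    if x 0 = x 1 then (if y = x then Complex.exp (-(φ : ℂ) * Complex.I) else 0)
    else if y 0 = y 1 then 0
    else Complex.exp ((φ : ℂ) * Complex.I) *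
      (if y = x then (Real.cos (2 * θ) : ℂ) else -(Complex.I * (Real.sin (2 * θ) : ℂ)))

/-- The one-symbol gate set `{xxzGate θ φ}` (alphabet `Unit`, arity `2`): the homogeneous
brickwork uses ONE fixed gate everywhere. [cite: LjubotinaZadnikProsen2019, eqs. (2)–(3)] -/
noncomputable def xxzGateSet (θ φ : ℝ) : QGateSet where
  Op := Unit
  arity := fun _ => 2
  mat := fun _ => xxzGate θ φ

/-- The gate alphabet `Unit` of `xxzGateSet θ φ` is encodable (needed for `IsUniform`; instance
search does not unfold the definition `xxzGateSet`). [folklore] -/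
instance instEncodableOp (θ φ : ℝ) : Encodable (xxzGateSet θ φ).Op :=
  inferInstanceAs (Encodable Unit)

/-- The bond `(j, j+1)` of an `N`-wire open chain as an embedding `Fin 2 ↪ Fin N`
(wire `0` of the gate sits on site `j`, wire `1` on site `j + 1`). [folklore] -/
def bond (N j : ℕ) (h : j + 1 < N) : Fin 2 ↪ Fin N :=
  ⟨fun i => ⟨j + i.val, by have := i.isLt; omega⟩,
    fun i i' hh => Fin.ext (by simp only [Fin.mk.injEq] at hh; omega)⟩

/-- Layer `s` of the brickwork on `N` wires (open chain): the gate on every bond `(j, j+1)` with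
`j ≡ s (mod 2)` and `j + 1 < N`, listed by increasing `j` (they act on disjoint wires). Even `s` is
`𝒰_even`-type (bonds `(0,1), (2,3), …`), odd `s` is `𝒰_odd`-type (bonds `(1,2), (3,4), …`).
[cite: LjubotinaZadnikProsen2019, eq. (2)] -/
noncomputable def brickLayer (θ φ : ℝ) (N s : ℕ) : List (QGate (xxzGateSet θ φ) N) :=
  (List.range N).filterMap fun j =>
    if h : j % 2 = s % 2 ∧ j + 1 < N then some (QGate.gate () (bond N j h.2)) else none

/-- The depth-`t` homogeneous XXZ brickwork circuit on `N` wires (open chain): layers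
`0, 1, …, t-1` in this order (even layer first), i.e. `⌊t/2⌋` Floquet periods `𝒰 = 𝒰_odd 𝒰_even`
plus one even layer when `t` is odd — the "integrable Trotterization" of the XXZ chain.
[cite: LjubotinaZadnikProsen2019, eqs. (2)–(3) and Suppl. App. B] -/
noncomputable def brickwork (θ φ : ℝ) (N t : ℕ) : QCircuit (xxzGateSet θ φ) N :=
  ⟨(List.range t).flatMap fun s => brickLayer θ φ N s⟩

/-- Acceptance probability of the depth-`t` brickwork run on `|y⟩|0^m⟩` (`|y| + m` wires), wire `0`
measured (Born rule of Q2's `acceptProb`). [folklore] -/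
noncomputable def xxzAccept (θ φ : ℝ) (m t : ℕ) (y : List Bool) : ℝ :=
  (brickwork θ φ (y.length + m) t).acceptProb 0 y.get

/-- The uniform brickwork family with `p n` ancillas and depth `q n` on inputs of length `n`.
[folklore] -/
noncomputable def xxzFamily (θ φ : ℝ) (p q : Polynomial ℕ) : QCircuitFamily (xxzGateSet θ φ) :=
  ⟨fun n => p.eval n, fun n => brickwork θ φ (n + p.eval n) (q.eval n)⟩

/-- `XXZBQPAt a b`: languages decided with error `≤ 1/3` (wire `0`) by the homogeneous brickwork
with angles `(a π, b π)`, polynomial ancilla count `p` and depth `q`, after a deterministic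
poly-time input encoding `f ∈ FP` (the program is written into the initial product state
`|f x⟩|0^{p |f x|}⟩`; the dynamics is the same fixed integrable circuit for every input).
Route-posited class of `QuantumAdvantage/YangBaxterIslands` (not a published notion). [folklore] -/
def XXZBQPAt (a b : ℚ) : Set (Language Bool) :=
  {L | ∃ (f : List Bool → List Bool) (p q : Polynomial ℕ), f ∈ FP ∧
    ∀ x, (x ∈ L → 2 / 3 ≤ (xxzFamily (a * Real.pi) (b * Real.pi) p q).acceptProbOn 0 (f x)) ∧
      (x ∉ L → (xxzFamily (a * Real.pi) (b * Real.pi) p q).acceptProbOn 0 (f x) ≤ 1 / 3)}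

/-- `XXZBQP`: languages decided by the homogeneous integrable XXZ brickwork for SOME rational
angle pair `(a, b)`, `XXZBQP = ⋃_{a b : ℚ} XXZBQPAt a b`. Route-posited class of
`QuantumAdvantage/YangBaxterIslands`. [folklore] -/
def XXZBQP : Set (Language Bool) := {L | ∃ a b : ℚ, L ∈ XXZBQPAt a b}

/-! ### Bridges to the literal signature of the route items -/

/-- `XXZBQPAt a b ⊆ XXZBQP`. [folklore] -/
theorem XXZBQPAt_subset_XXZBQP (a b : ℚ) : XXZBQPAt a b ⊆ XXZBQP := fun _ hL => ⟨a, b, hL⟩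

/-- Membership in `XXZBQPAt a b`, stated against the LITERAL signature inlined by the items of
route `QuantumAdvantage/YangBaxterIslands` (anonymous gate set, family given by an equation
`F = ⟨…⟩`). [folklore] -/
theorem mem_XXZBQPAt_iff (a b : ℚ) (L : Language Bool) :
    L ∈ XXZBQPAt a b ↔
      ∃ (f : List Bool → List Bool) (p q : Polynomial ℕ),
        f ∈ Literature.Computability.Complexity.FP ∧
        ∃ F : Literature.Computability.Cryptography.QCircuitFamily
            (⟨Unit, fun _ => 2, fun _ => Matrix.of fun u v : Fin 2 → Bool =>
              if u 0 = u 1 then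
                (if v = u then Complex.exp (-((((b : ℝ) * Real.pi) : ℝ) : ℂ) * Complex.I) else 0)
              else if v 0 = v 1 then 0
              else Complex.exp (((((b : ℝ) * Real.pi) : ℝ) : ℂ) * Complex.I) *
                (if v = u then ((Real.cos (2 * ((a : ℝ) * Real.pi)) : ℝ) : ℂ)
                  else -(Complex.I * ((Real.sin (2 * ((a : ℝ) * Real.pi)) : ℝ) : ℂ)))⟩ :
              Literature.Computability.Cryptography.QGateSet),
          F = ⟨fun n => p.eval n, fun n => ⟨(List.range (q.eval n)).flatMap fun s =>
            (List.range (n + p.eval n)).filterMap fun j =>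
              if h : j % 2 = s % 2 ∧ j + 1 < (n + p.eval n) then
                some (Literature.Computability.Cryptography.QGate.gate ()
                  ⟨fun i : Fin 2 => ⟨j + i.val, by have := i.isLt; omega⟩,
                    fun i i' hh => Fin.ext (by simp only [Fin.mk.injEq] at hh; omega)⟩)
              else none⟩⟩ ∧
          ∀ x : List Bool, (x ∈ L → (2 : ℝ) / 3 ≤ F.acceptProbOn 0 (f x)) ∧
            (x ∉ L → F.acceptProbOn 0 (f x) ≤ 1 / 3) := by
  simp only [XXZBQPAt, Set.mem_setOf_eq, exists_eq_left]
  rfl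

/-- Membership in `XXZBQP`, stated against the LITERAL signature inlined by the items `YbTarget`,
`YbIsland`, `YbHardness`, `YbMembership`, `YbDiagTTToPPoly` of route
`QuantumAdvantage/YangBaxterIslands`. [folklore] -/
theorem mem_XXZBQP_iff (L : Language Bool) :
    L ∈ XXZBQP ↔
      ∃ a b : ℚ, ∃ (f : List Bool → List Bool) (p q : Polynomial ℕ),
        f ∈ Literature.Computability.Complexity.FP ∧
        ∃ F : Literature.Computability.Cryptography.QCircuitFamily
            (⟨Unit, fun _ => 2, fun _ => Matrix.of fun u v : Fin 2 → Bool =>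
              if u 0 = u 1 then
                (if v = u then Complex.exp (-((((b : ℝ) * Real.pi) : ℝ) : ℂ) * Complex.I) else 0)
              else if v 0 = v 1 then 0
              else Complex.exp (((((b : ℝ) * Real.pi) : ℝ) : ℂ) * Complex.I) *
                (if v = u then ((Real.cos (2 * ((a : ℝ) * Real.pi)) : ℝ) : ℂ)
                  else -(Complex.I * ((Real.sin (2 * ((a : ℝ) * Real.pi)) : ℝ) : ℂ)))⟩ :
              Literature.Computability.Cryptography.QGateSet),
          F = ⟨fun n => p.eval n, fun n => ⟨(List.range (q.eval n)).flatMap fun s =>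
            (List.range (n + p.eval n)).filterMap fun j =>
              if h : j % 2 = s % 2 ∧ j + 1 < (n + p.eval n) then
                some (Literature.Computability.Cryptography.QGate.gate ()
                  ⟨fun i : Fin 2 => ⟨j + i.val, by have := i.isLt; omega⟩,
                    fun i i' hh => Fin.ext (by simp only [Fin.mk.injEq] at hh; omega)⟩)
              else none⟩⟩ ∧
          ∀ x : List Bool, (x ∈ L → (2 : ℝ) / 3 ≤ F.acceptProbOn 0 (f x)) ∧
            (x ∉ L → F.acceptProbOn 0 (f x) ≤ 1 / 3) := by
  simp only [XXZBQP, XXZBQPAt, Set.mem_setOf_eq, exists_eq_left]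
  rfl

/-! ### Bookkeeping -/

/-- The family's acceptance probability on input `y` is `xxzAccept` with `p |y|` ancillas and depth
`q |y|` (definitional). [folklore] -/
theorem acceptProbOn_xxzFamily (θ φ : ℝ) (p q : Polynomial ℕ) (y : List Bool) :
    (xxzFamily θ φ p q).acceptProbOn 0 y = xxzAccept θ φ (p.eval y.length) (q.eval y.length) y :=
  rfl

/-- The wires of the bond `(j, j+1)`: wire `i` of the gate sits on site `j + i`. [folklore] -/
@[simp] theorem coe_bond_apply (N j : ℕ) (h : j + 1 < N) (i : Fin 2) : (bond N j h i : ℕ) = j + i :=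
  rfl

/-- The depth-`0` brickwork is the empty circuit. [folklore] -/
@[simp] theorem brickwork_zero (θ φ : ℝ) (N : ℕ) : brickwork θ φ N 0 = ⟨[]⟩ := rfl

/-- Depth recursion: the depth-`(t+1)` brickwork is the depth-`t` brickwork followed by layer `t`
(so `U_{t+1} = U_{layer t} · U_t`, `QCircuit.toMatrix_append`). [folklore] -/
theorem brickwork_succ (θ φ : ℝ) (N t : ℕ) :
    brickwork θ φ N (t + 1) = (brickwork θ φ N t).append ⟨brickLayer θ φ N t⟩ := by
  simp [brickwork, QCircuit.append, List.range_succ, List.flatMap_append]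

/-- Matrix form of the depth recursion: `U_{t+1} = U_{layer t} U_t` (for every oracle `A`; the
circuits are oracle-free anyway). [folklore] -/
theorem toMatrix_brickwork_succ (θ φ : ℝ) (N t : ℕ) (A : Language Bool) :
    (brickwork θ φ N (t + 1)).toMatrix A =
      (⟨brickLayer θ φ N t⟩ : QCircuit (xxzGateSet θ φ) N).toMatrix A *
        (brickwork θ φ N t).toMatrix A := by
  rw [brickwork_succ, QCircuit.toMatrix_append]

/-- Brickwork circuits are oracle-free (they consist of placed gate symbols only). [folklore] -/
theorem brickwork_isOracleFree (θ φ : ℝ) (N t : ℕ) : (brickwork θ φ N t).IsOracleFree := by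
  intro g hg
  simp only [brickwork, brickLayer, List.mem_flatMap, List.mem_filterMap] at hg
  obtain ⟨s, -, j, -, hj⟩ := hg
  split_ifs at hj with h
  cases hj
  trivial

/-- The brickwork family is oracle-free. [folklore] -/
theorem xxzFamily_isOracleFree (θ φ : ℝ) (p q : Polynomial ℕ) :
    (xxzFamily θ φ p q).IsOracleFree := fun _ => brickwork_isOracleFree θ φ _ _

/-- A layer on `N` wires has at most `N` gates (in fact `≤ N / 2`). [folklore] -/
theorem length_brickLayer_le (θ φ : ℝ) (N s : ℕ) : (brickLayer θ φ N s).length ≤ N := by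
  unfold brickLayer
  exact (List.length_filterMap_le _ _).trans (List.length_range ▸ le_rfl)

/-- The depth-`t` brickwork on `N` wires has at most `t * N` gates. [folklore] -/
theorem size_brickwork_le (θ φ : ℝ) (N t : ℕ) : (brickwork θ φ N t).size ≤ t * N := by
  simp only [QCircuit.size, brickwork, List.length_flatMap]
  have : ∀ x ∈ (List.range t).map fun s => (brickLayer θ φ N s).length, x ≤ N := by
    simp only [List.mem_map, List.mem_range, forall_exists_index, and_imp]
    rintro _ s - rfl
    exact length_brickLayer_le θ φ N s
  simpa using List.sum_le_card_nsmul _ N this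

/-! ### Entries, `U(1)` symmetry, unitarity, the classical lines -/

/-- Entries of the XXZ gate (definitional unfolding of `xxzGate`).
[cite: LjubotinaZadnikProsen2019, eq. (3)] -/
theorem xxzGate_apply (θ φ : ℝ) (x y : QReg 2) :
    xxzGate θ φ x y =
      if x 0 = x 1 then (if y = x then Complex.exp (-(φ : ℂ) * Complex.I) else 0)
      else if y 0 = y 1 then 0
      else Complex.exp ((φ : ℂ) * Complex.I) *
        (if y = x then (Real.cos (2 * θ) : ℂ) else -(Complex.I * (Real.sin (2 * θ) : ℂ))) :=
  rfl

/-- Equality of two-bit vectors is equality of the bits. (The two-wire helpers `x = ![x 0, x 1]`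
and `∑ z, Φ z = ∑ a b, Φ ![a, b]` exist in the tree as `QubitRouting.qReg_two_eq` /
`ForrelationThm25Amplitude.sum_qReg_two`; they are re-derived inline below rather than imported,
to keep this definition file's import closure at Q1/Q2/G01.) [folklore] -/
@[simp] theorem vecTwo_eq_vecTwo_iff (a b c d : Bool) :
    ((![a, b] : QReg 2) = ![c, d]) ↔ (a = c ∧ b = d) := by
  revert a b c d
  decide

/-- **`U(1)` symmetry of the gate.** The XXZ gate conserves the number of up-spins: its `(x, y)`
entry vanishes unless `x` and `y` have the same Hamming weight (so the total magnetisation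
`M = ∑ₙ σᶻₙ` commutes with the brickwork propagator).
[cite: LjubotinaZadnikProsen2019, p. 2 Spin currents (U(1) symmetry of the propagator (4))] -/
theorem xxzGate_apply_eq_zero_of_weight_ne (θ φ : ℝ) {x y : QReg 2}
    (h : (x 0).toNat + (x 1).toNat ≠ (y 0).toNat + (y 1).toNat) : xxzGate θ φ x y = 0 := by
  obtain ⟨a, b, rfl⟩ : ∃ a b : Bool, x = ![a, b] := ⟨x 0, x 1, by funext i; fin_cases i <;> rfl⟩
  obtain ⟨c, d, rfl⟩ : ∃ c d : Bool, y = ![c, d] := ⟨y 0, y 1, by funext i; fin_cases i <;> rfl⟩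
  simp only [Matrix.cons_val_zero, Matrix.cons_val_one] at h
  cases a <;> cases b <;> cases c <;> cases d <;> simp [xxzGate_apply] at h ⊢

/-- `U U† = 1` for the XXZ gate: the even block is the unit-modulus scalar `e^{-iφ}`, the odd block
is `e^{iφ}` times the unitary `[[cos 2θ, -i sin 2θ], [-i sin 2θ, cos 2θ]]` (`cos² + sin² = 1`).
[cite: LjubotinaZadnikProsen2019, eq. (3) (a unitary gate acting on two neighbouring sites)] -/
theorem xxzGate_mul_conjTranspose (θ φ : ℝ) : xxzGate θ φ * (xxzGate θ φ)ᴴ = 1 := by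
  -- the scalar identities behind the sixteen entries
  have hP : Complex.exp (-((φ : ℂ) * Complex.I)) *
      (starRingEnd ℂ) (Complex.exp (-((φ : ℂ) * Complex.I))) = 1 := by
    rw [← Complex.exp_conj, ← Complex.exp_add, map_neg, map_mul, Complex.conj_ofReal,
      Complex.conj_I, mul_neg, neg_neg, neg_add_cancel, Complex.exp_zero]
  have hE : Complex.exp ((φ : ℂ) * Complex.I) *
      (starRingEnd ℂ) (Complex.exp ((φ : ℂ) * Complex.I)) = 1 := by
    rw [← Complex.exp_conj, ← Complex.exp_add, map_mul, Complex.conj_ofReal, Complex.conj_I,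
      mul_neg, add_neg_cancel, Complex.exp_zero]
  have hCS : ((Real.cos (2 * θ) : ℝ) : ℂ) ^ 2 + ((Real.sin (2 * θ) : ℝ) : ℂ) ^ 2 = 1 := by
    exact_mod_cast Real.cos_sq_add_sin_sq (2 * θ)
  have hsum : ∀ Φ : QReg 2 → ℂ, ∑ z, Φ z = ∑ a : Bool, ∑ b : Bool, Φ ![a, b] := fun Φ => by
    rw [← Fintype.sum_prod_type']
    exact Fintype.sum_equiv (finTwoArrowEquiv Bool) _ _ fun z => by
      congr 1; funext i; fin_cases i <;> rfl
  ext x y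
  obtain ⟨a, b, rfl⟩ : ∃ a b : Bool, x = ![a, b] := ⟨x 0, x 1, by funext i; fin_cases i <;> rfl⟩
  obtain ⟨c, d, rfl⟩ : ∃ c d : Bool, y = ![c, d] := ⟨y 0, y 1, by funext i; fin_cases i <;> rfl⟩
  simp only [Matrix.mul_apply, hsum, Fintype.sum_bool, Matrix.conjTranspose_apply,
    xxzGate_apply, Matrix.one_apply, vecTwo_eq_vecTwo_iff, Matrix.cons_val_zero,
    Matrix.cons_val_one]
  cases a <;> cases b <;> cases c <;> cases d <;>
    simp [-Complex.ofReal_cos, -Complex.ofReal_sin] <;>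
    first
    | exact hP
    | ring1
    | linear_combination (((Real.cos (2 * θ) : ℝ) : ℂ) ^ 2 -
        Complex.I ^ 2 * ((Real.sin (2 * θ) : ℝ) : ℂ) ^ 2) * hE + hCS -
        ((Real.sin (2 * θ) : ℝ) : ℂ) ^ 2 * Complex.I_sq

/-- **The XXZ gate is unitary.** [cite: LjubotinaZadnikProsen2019, eq. (3)] -/
theorem xxzGate_mem_unitaryGroup (θ φ : ℝ) : xxzGate θ φ ∈ Matrix.unitaryGroup (QReg 2) ℂ := by
  rw [Matrix.mem_unitaryGroup_iff, Matrix.star_eq_conjTranspose]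
  exact xxzGate_mul_conjTranspose θ φ

/-- The XXZ gate set is unitary (so `acceptProb ≤ 1`, `outputPMF_apply`, … of Q2 apply to the
brickwork). [cite: LjubotinaZadnikProsen2019, eq. (3)] -/
theorem xxzGateSet_isUnitary (θ φ : ℝ) : (xxzGateSet θ φ).IsUnitary :=
  fun _ => xxzGate_mem_unitaryGroup θ φ

/-- **The diagonal line.** If `sin 2θ = 0` (`θ ∈ (π/2)ℤ`, i.e. angles `a ∈ ½ℤ`) the XXZ gate is
diagonal, so the brickwork maps every basis state to itself up to a phase (route item
`YbTrivialLines` (i)). [folklore] -/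
theorem xxzGate_of_sin_eq_zero {θ : ℝ} (φ : ℝ) (h : Real.sin (2 * θ) = 0) :
    xxzGate θ φ = Matrix.diagonal fun x : QReg 2 =>
      if x 0 = x 1 then Complex.exp (-(φ : ℂ) * Complex.I)
      else Complex.exp ((φ : ℂ) * Complex.I) * (Real.cos (2 * θ) : ℂ) := by
  ext x y
  obtain ⟨a, b, rfl⟩ : ∃ a b : Bool, x = ![a, b] := ⟨x 0, x 1, by funext i; fin_cases i <;> rfl⟩
  obtain ⟨c, d, rfl⟩ : ∃ c d : Bool, y = ![c, d] := ⟨y 0, y 1, by funext i; fin_cases i <;> rfl⟩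
  simp only [xxzGate_apply, Matrix.diagonal_apply, vecTwo_eq_vecTwo_iff, Matrix.cons_val_zero,
    Matrix.cons_val_one]
  cases a <;> cases b <;> cases c <;> cases d <;> simp [h]

/-- **The dual-unitary (SWAP) line.** If `cos 2θ = 0` (`θ ∈ π/4 + (π/2)ℤ`, i.e. angles
`a ∈ ¼ + ½ℤ`) the XXZ gate is SWAP followed by diagonal phases: `|x₀ x₁⟩ ↦ c(x) |x₁ x₀⟩`, so the
brickwork maps basis states to basis states along a wire permutation (route item
`YbTrivialLines` (ii)). [folklore] -/
theorem xxzGate_of_cos_eq_zero {θ : ℝ} (φ : ℝ) (h : Real.cos (2 * θ) = 0) :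
    xxzGate θ φ = Matrix.of fun x y : QReg 2 =>
      if y = ![x 1, x 0] then
        (if x 0 = x 1 then Complex.exp (-(φ : ℂ) * Complex.I)
          else -(Complex.exp ((φ : ℂ) * Complex.I) * (Complex.I * (Real.sin (2 * θ) : ℂ))))
      else 0 := by
  ext x y
  obtain ⟨a, b, rfl⟩ : ∃ a b : Bool, x = ![a, b] := ⟨x 0, x 1, by funext i; fin_cases i <;> rfl⟩
  obtain ⟨c, d, rfl⟩ : ∃ c d : Bool, y = ![c, d] := ⟨y 0, y 1, by funext i; fin_cases i <;> rfl⟩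
  simp only [xxzGate_apply, Matrix.of_apply, vecTwo_eq_vecTwo_iff, Matrix.cons_val_zero,
    Matrix.cons_val_one]
  cases a <;> cases b <;> cases c <;> cases d <;> simp [h]

end Literature.Computability.QuantumComplexity.IntegrableBrickwork
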